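import Literature.MathematicalPhysics.QuantumFieldTheory.Balaban1983to89.B8Eq1119LambdaAnalytic

/-!
# `Balaban1983to89.B8Eq1123LambdaSpace` — T. Bałaban, *Spaces of regular gauge field configurations on a lattice and gauge fixing
# conditions*, Commun. Math. Phys. **99** (1985) 75–102 [Balaban1985RegularSpaces], Sect. E pp. 96–97: the functional derivative (1.123)
# «⟨(δ/δλ)C′(λ), λ₀⟩ = d/dτ C′(λ + τλ₀)|_{τ=0}», «defined as the linear mapping», and its bound (1.125) «|⟨(δ/δλ)C′(λ), λ₀⟩| ≦
# C′₂·2max{|λ₀|, |Dλ₀|}(α₃ + α₄)» — ON THE BANACH λ-SPACE OF (1.119) (unit r05's `B8Eq1119LambdaSpace`), FOR THE CONCRETE LATTICE `C′`: the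
# functional derivative IS the Fréchet derivative of `C′ : λ-space → X-space`, a bounded operator of norm `≤ C′₂·2(α₃ + α₄)` (file 7 of the p05
# gen-6 series)

statement-level skeleton of published theorems with citation tags; proofs where landed; nothing here is a claim about the Yang–Mills mass gap

PDF held: `paper:balaban1985-cmp99-regular-spaces-gauge-fixing` (journal page = PDF page + 74); p. 96 [PDF 22] / p. 97 [PDF 23] (text layer,
this unit, 2026-08-21): «where the functional derivative (δ/δλ)C′(λ) is defined as the linear mapping ⟨(δ/δλ)C′(λ), λ₀⟩ = (d/dτ)C′(λ +
τλ₀)|_{τ=0}. (1.123) Using the analyticity properties of C′(λ), the derivative above can be written as (1/2πi)∮_{|τ|=r} dτ τ⁻² C′(λ + τλ₀).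
(1.124) Taking r = (2max{|λ₀|, |Dλ₀|})⁻¹α₄, we get the estimate |⟨(δ/δλ)C′(λ), λ₀⟩| ≦ C′₂ 2max{|λ₀|, |Dλ₀|}(α₃ + α₄). (1.125)»

CITATION HEADER (lean-in-tree rule).  Cell `lit-balaban` (HOME `run/shared/lean/pub/lit-balaban/`), unit `lit-balaban-p05` (Phase-2 proof
seat p05, gen 6; TAKING line HOME/STATUS.md 2026-08-21T09:39:21Z and sequel; free-target protocol G.5-34(d); owner of block B8 =
`lit-balaban-r05`, referee ref-4).  Row served: **`B8.Eq1.125`** ((1.122)–(1.125); proved-existing abstractly `B8Ineq125`, sitewise on the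
concrete carrier `B8Eq1123Concrete`/`B8Ineq125Concrete` (this unit, gen 5), Lipschitz form on the λ-space `B8Eq1119LambdaSpace.h125_concrete`
(r05)) — HERE the OPERATOR form on the λ-space `lamSub U₀ (Lᵏ)` (norm = print's modulus `max{|λ|, Lᵏ|D_{U₀}λ|}`): by `B8Eq1119LambdaAnalytic`
(this unit) the concrete `C′ = Cc` is analytic there, so (1.123) is a genuine Fréchet derivative.

WHAT THIS FILE PROVES (kernel, no `sorry`, standard axioms; theorems only; standing hypotheses = `B8Eq1119LambdaSpace` §3 / p05's
`B8Eq1117Concrete.eq1117_existsUnique`):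
* `hasFDerivAt_Cc` — `C′` is Fréchet differentiable at every `‖μ‖ < α₄`.
* **`norm_fderiv_Cc_le`** — (1.125) IN OPERATOR NORM: `‖DC′(μ)‖ ≤ 2·C′₂(α₃ + α₄)`, `C′₂ := 2·C2p d` (from the Lipschitz form
  `B8Eq1119LambdaSpace.h125_concrete` and Mathlib `HasFDerivAt.le_of_lip'`).
* **`fderiv_Cc_apply`** — (1.123): the Fréchet derivative applied to a direction `λ₀` of the λ-space IS, coordinatewise, the functional
  derivative `⟨(δ/δλ)C′_j(u₁, λ_μ), λ₀⟩(z) = d/dτ C′_j(u₁, λ_μ + τλ₀)(z)|₀` of `B8Eq1123Concrete.dCnl` (chain rule along the line `τ ↦ μ + τλ₀`).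
* **`norm_dCnl_lamOf_le`** — (1.125) IN PRINT'S LETTER on the λ-space: `‖⟨(δ/δλ)C′_j(u₁, λ_μ), λ₀⟩(z)‖ ≤ C′₂·2·‖λ₀‖·(α₃ + α₄)` with
  `‖λ₀‖ = max{|λ₀|, Lᵏ|Dλ₀|}`, all `j ≤ k`, `z`; `dCnl_lamOf_add`, `dCnl_lamOf_smul` — «defined as the linear mapping».
READINGS: as in the series (one-level weight `w = Lᵏ`; `𝔤ᶜ`-values; `C′₂ := 2·C2p d`, GAPS G-B8-17 — (1.125) on the full-size set (1.120)).
REUSED BY NAME: `B8Eq1119LambdaAnalytic.analyticOnNhd_Cc` (this unit), `B8Eq1119LambdaSpace.Cc, Cc_apply, h125_concrete, lamOf, lamOf_add,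
lamOf_smul` (r05), `B8Eq1123Concrete.dCnl, Cnl` (this unit, gen 5), Mathlib `HasFDerivAt.le_of_lip'`, `HasFDerivAt.comp_hasDerivAt`,
`HasDerivAt.deriv`, `BoundedContinuousFunction.evalCLM`.
Unit `lit-balaban-p05` (gen 6), 2026-08-21.  Nothing here is new mathematics.

[cite: Balaban1985RegularSpaces, (1.123)–(1.125) pp.96–97; Balaban1985Averaging, (208), (214) p.50]
-/

noncomputable section

open NormedSpace Finset Metric Set Filter
open scoped BoundedContinuousFunction Topology NNReal

namespace Literature.MathematicalPhysics.QuantumFieldTheory.Balaban1983to89.B8Eq1123LambdaSpace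

open B7Prop1Explicit B7Prop2Explicit MatrixLog B7Eq167Flat B7Prop9Flat B7Prop10General
open B7Prop10Flat (one_le_C5 C4'_nonneg C5'_nonneg)
open B7Eq214General (Cgen)
open B7Eq170Flat (cj)
open B8Eq1123Concrete (Cnl dCnl)
open B8Ineq125Concrete (C2p C2p_nonneg)
open B8Eq1117Concrete (XSpace CnlF)
open B8Eq1119LambdaSpace (PSpace PairIdx lamSub lamOf lamOf_add lamOf_smul Cc Cc_apply h125_concrete)
open B8Eq1119LambdaAnalytic (analyticOnNhd_Cc)

-- `Site` alone would resolve to the torus sites of `Setup.lean`; re-export the `ℤ^d` sites of `B7Prop1Explicit`.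
export B7Prop1Explicit (Site)

variable {d : ℕ}

section Standing

variable {𝔸 : Type*} [NormedRing 𝔸] [NormOneClass 𝔸] [NormedAlgebra ℂ 𝔸] [CompleteSpace 𝔸]
variable {L : ℕ} {G : Subgroup 𝔸ˣ} {U₀ : Site d → Fin d → 𝔸ˣ} {k : ℕ} {u₁ : Site d → 𝔸ˣ} {α₀ α₃ α₄ : ℝ}

variable (hL : 2 ≤ L) (hG : AvgClosed d L G) (hU : ∀ x κ, U₀ x κ ∈ G)
  (hα : 0 < α₀) (hα3 : C0 d * α₀ ≤ 1 / 3) (hα2 : 2 * α₀ ≤ c2' d L)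
  (h52 : pdev U₀ < α₀ * (((L : ℝ) ^ k)⁻¹) ^ 2)
  (hu₁ : InLambda L U₀ u₁ k α₃ (((L : ℝ) ^ k)⁻¹))
  (hα₃ : 0 ≤ α₃) (hα₃' : α₃ ≤ 1 / 200) (hα₄ : 0 < α₄)
  (hs₁ : 200 * C6 d * (2 * α₄) ≤ 1) (hs₂ : 12000 * ((d : ℝ) + 1) * L * (2 * α₄) ≤ 1)
  (hs₃ : C4G d L * (α₀ + α₃ + 4 * (2 * α₄)) ≤ 1)
  (hs₄ : 1024 * ((d : ℝ) + 1) * ((d : ℝ) + 4) * L ^ 2 * α₀ ≤ 1) (hs₅ : 32 * ((d : ℝ) + 1) ^ 2 * C6 d * L ^ 2 * α₀ ≤ 1)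
  (hs₆ : 16 * d * C5' d * C6 d * (L : ℝ) ^ 2 * α₀ ≤ 1) (hs₇ : 8 * d * C6 d * L * α₀ ≤ 1)

include hL hG hU hα hα3 hα2 h52 hu₁ hα₃ hα₃' hα₄ hs₁ hs₂ hs₃ hs₄ hs₅ hs₆ hs₇

/-- **`C′` is Fréchet differentiable on the ball `‖μ‖ < α₄` of the λ-space** (it is analytic there, `B8Eq1119LambdaAnalytic.analyticOnNhd_Cc`),
with derivative `fderiv ℂ C′ μ`. [cite: Balaban1985RegularSpaces, (1.123) p.96; Balaban1985Averaging, (208) p.50] -/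
theorem hasFDerivAt_Cc {μ : lamSub U₀ ((L : ℝ) ^ k)} (hμ : ‖μ‖ < α₄) :
    HasFDerivAt (Cc L U₀ u₁ k) (fderiv ℂ (Cc L U₀ u₁ k) μ) μ :=
  ((analyticOnNhd_Cc hL hG hU hα hα3 hα2 h52 hu₁ hα₃ hα₃' hα₄ hs₁ hs₂ hs₃ hs₄ hs₅ hs₆ hs₇ μ hμ).differentiableAt).hasFDerivAt

/-- **(1.125) IN OPERATOR NORM on the λ-space**: `‖DC′(μ)‖ ≤ 2·C′₂(α₃ + α₄)` for `‖μ‖ < α₄`, `C′₂ := 2·C2p d` — the Lipschitz form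
`B8Eq1119LambdaSpace.h125_concrete` («|C′(μ₁) − C′(μ₂)| ≦ C′₂·2·max{…}(α₃ + α₄)», valid on the whole open ball, a neighbourhood of `μ`)
bounds the norm of the Fréchet derivative (`HasFDerivAt.le_of_lip'`). [cite: Balaban1985RegularSpaces, (1.125) p.97] -/
theorem norm_fderiv_Cc_le {μ : lamSub U₀ ((L : ℝ) ^ k)} (hμ : ‖μ‖ < α₄) :
    ‖fderiv ℂ (Cc L U₀ u₁ k) μ‖ ≤ 2 * (2 * C2p d) * (α₃ + α₄) := by
  have h0 : 0 ≤ 2 * (2 * C2p d) * (α₃ + α₄) := by have := C2p_nonneg d; positivity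
  refine (hasFDerivAt_Cc hL hG hU hα hα3 hα2 h52 hu₁ hα₃ hα₃' hα₄ hs₁ hs₂ hs₃ hs₄ hs₅ hs₆ hs₇ hμ).le_of_lip' h0 ?_
  have hopen : IsOpen {ν : lamSub U₀ ((L : ℝ) ^ k) | ‖ν‖ < α₄} := isOpen_lt continuous_norm continuous_const
  filter_upwards [hopen.mem_nhds hμ] with ν hν
  exact h125_concrete hL hG hU hα hα3 hα2 h52 hu₁ hα₃ hα₃' hα₄ hs₁ hs₂ hs₃ hs₄ hs₅ hs₆ hs₇ ν μ hν hμ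

/-- **(1.123) «⟨(δ/δλ)C′(λ), λ₀⟩ = (d/dτ)C′(λ + τλ₀)|_{τ=0}» ON THE λ-SPACE**: for `‖μ‖ < α₄` and every direction `λ₀` of the λ-space, the
Fréchet derivative `DC′(μ)λ₀` has, at every level `j ≤ k` and site `z`, the coordinate `⟨(δ/δλ)C′_j(u₁, λ_μ), λ₀⟩(z)` — the τ-derivative at
`0` of `C′_j(u₁, λ_μ + τλ₀)(z)` (`B8Eq1123Concrete.dCnl`).  Proof: chain rule along the line `τ ↦ μ + τλ₀`, evaluation at `(j, z)` is a
continuous linear map, and `C′(μ + τλ₀)` agrees coordinatewise with the genuine family near `τ = 0`.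
[cite: Balaban1985RegularSpaces, (1.123) p.96] -/
theorem fderiv_Cc_apply {μ : lamSub U₀ ((L : ℝ) ^ k)} (hμ : ‖μ‖ < α₄) (lam₀ : lamSub U₀ ((L : ℝ) ^ k))
    (p : Fin (k + 1) × Site d) :
    fderiv ℂ (Cc L U₀ u₁ k) μ lam₀ p = dCnl L U₀ u₁ p.1 (lamOf μ) (lamOf lam₀) p.2 := by
  -- the curve τ ↦ C′(μ + τλ₀) and its derivative at 0 (chain rule)
  have hline : HasDerivAt (fun τ : ℂ => μ + τ • lam₀) lam₀ 0 := by
    simpa using ((hasDerivAt_id (0 : ℂ)).smul_const lam₀).const_add μ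
  have hF := hasFDerivAt_Cc hL hG hU hα hα3 hα2 h52 hu₁ hα₃ hα₃' hα₄ hs₁ hs₂ hs₃ hs₄ hs₅ hs₆ hs₇ hμ
  have hF0 : HasFDerivAt (Cc L U₀ u₁ k) (fderiv ℂ (Cc L U₀ u₁ k) μ) (μ + (0 : ℂ) • lam₀) := by
    simpa using hF
  have hcurve : HasDerivAt ((Cc L U₀ u₁ k) ∘ fun τ : ℂ => μ + τ • lam₀) (fderiv ℂ (Cc L U₀ u₁ k) μ lam₀) 0 :=
    hF0.comp_hasDerivAt (0 : ℂ) hline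
  -- evaluate at the coordinate p
  have hcoord : HasDerivAt (fun τ : ℂ => Cc L U₀ u₁ k (μ + τ • lam₀) p) (fderiv ℂ (Cc L U₀ u₁ k) μ lam₀ p) 0 := by
    have h := (BoundedContinuousFunction.evalCLM ℂ p).hasFDerivAt.comp_hasDerivAt (0 : ℂ) hcurve
    simpa only [BoundedContinuousFunction.evalCLM_apply, Function.comp_def] using h
  -- near τ = 0 the packaged C′ is the genuine family at λ_μ + τλ₀
  have hcont : Continuous fun τ : ℂ => μ + τ • lam₀ := by fun_prop
  have hopen : IsOpen {τ : ℂ | ‖μ + τ • lam₀‖ < α₄} := (isOpen_lt continuous_norm continuous_const).preimage hcont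
  have h0mem : (0 : ℂ) ∈ {τ : ℂ | ‖μ + τ • lam₀‖ < α₄} := by simpa using hμ
  have heq : (fun τ : ℂ => Cnl L U₀ u₁ p.1 (lamOf μ + τ • lamOf lam₀) p.2) =ᶠ[𝓝 0]
      fun τ : ℂ => Cc L U₀ u₁ k (μ + τ • lam₀) p := by
    filter_upwards [hopen.mem_nhds h0mem] with τ hτ
    rw [Cc_apply hL hG hU hα hα3 hα2 h52 hu₁ hα₃ hα₃' hα₄ hs₁ hs₂ hs₃ hs₄ hs₅ hs₆ hs₇ hτ p, lamOf_add, lamOf_smul]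
  have hderiv : HasDerivAt (fun τ : ℂ => Cnl L U₀ u₁ p.1 (lamOf μ + τ • lamOf lam₀) p.2) (fderiv ℂ (Cc L U₀ u₁ k) μ lam₀ p) 0 :=
    hcoord.congr_of_eventuallyEq heq
  rw [dCnl, hderiv.deriv]

/-- **(1.125) IN PRINT'S LETTER on the λ-space**: «|⟨(δ/δλ)C′(λ), λ₀⟩| ≦ C′₂·2max{|λ₀|, |Dλ₀|}(α₃ + α₄)» — for `‖μ‖ < α₄`, every direction
`λ₀` of the λ-space (`‖λ₀‖ = max{|λ₀|, Lᵏ|D_{U₀}λ₀|}`), all `j ≤ k`, `z`: `‖⟨(δ/δλ)C′_j(u₁, λ_μ), λ₀⟩(z)‖ ≤ 2·C′₂·(α₃ + α₄)·‖λ₀‖`, `C′₂ := 2·C2p d`.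
[cite: Balaban1985RegularSpaces, (1.125) p.97] -/
theorem norm_dCnl_lamOf_le {μ : lamSub U₀ ((L : ℝ) ^ k)} (hμ : ‖μ‖ < α₄) (lam₀ : lamSub U₀ ((L : ℝ) ^ k)) :
    ∀ j ≤ k, ∀ z : Site d, ‖dCnl L U₀ u₁ j (lamOf μ) (lamOf lam₀) z‖ ≤ 2 * (2 * C2p d) * (α₃ + α₄) * ‖lam₀‖ := by
  intro j hj z
  have happ := fderiv_Cc_apply hL hG hU hα hα3 hα2 h52 hu₁ hα₃ hα₃' hα₄ hs₁ hs₂ hs₃ hs₄ hs₅ hs₆ hs₇ hμ lam₀ (⟨j, Nat.lt_succ_of_le hj⟩, z)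
  rw [← happ]
  calc ‖fderiv ℂ (Cc L U₀ u₁ k) μ lam₀ (⟨j, Nat.lt_succ_of_le hj⟩, z)‖ ≤ ‖fderiv ℂ (Cc L U₀ u₁ k) μ lam₀‖ :=
        BoundedContinuousFunction.norm_coe_le_norm _ _
    _ ≤ ‖fderiv ℂ (Cc L U₀ u₁ k) μ‖ * ‖lam₀‖ := ContinuousLinearMap.le_opNorm _ _
    _ ≤ 2 * (2 * C2p d) * (α₃ + α₄) * ‖lam₀‖ := by
        gcongr; exact norm_fderiv_Cc_le hL hG hU hα hα3 hα2 h52 hu₁ hα₃ hα₃' hα₄ hs₁ hs₂ hs₃ hs₄ hs₅ hs₆ hs₇ hμ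

/-- **(1.123) «defined as the linear mapping» — additivity in the direction** on the λ-space (the coordinates of a continuous linear map).
[cite: Balaban1985RegularSpaces, (1.123) p.96] -/
theorem dCnl_lamOf_add {μ : lamSub U₀ ((L : ℝ) ^ k)} (hμ : ‖μ‖ < α₄) (lam₀ lam₁ : lamSub U₀ ((L : ℝ) ^ k)) :
    ∀ j ≤ k, ∀ z : Site d, dCnl L U₀ u₁ j (lamOf μ) (lamOf (lam₀ + lam₁)) z =
      dCnl L U₀ u₁ j (lamOf μ) (lamOf lam₀) z + dCnl L U₀ u₁ j (lamOf μ) (lamOf lam₁) z := by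
  intro j hj z
  have h := fun ν => fderiv_Cc_apply hL hG hU hα hα3 hα2 h52 hu₁ hα₃ hα₃' hα₄ hs₁ hs₂ hs₃ hs₄ hs₅ hs₆ hs₇ hμ ν
    (⟨j, Nat.lt_succ_of_le hj⟩, z)
  rw [← h, ← h, ← h, map_add]
  rfl

/-- **(1.123) «defined as the linear mapping» — homogeneity in the direction** on the λ-space. [cite: Balaban1985RegularSpaces, (1.123) p.96] -/
theorem dCnl_lamOf_smul {μ : lamSub U₀ ((L : ℝ) ^ k)} (hμ : ‖μ‖ < α₄) (c : ℂ) (lam₀ : lamSub U₀ ((L : ℝ) ^ k)) :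
    ∀ j ≤ k, ∀ z : Site d, dCnl L U₀ u₁ j (lamOf μ) (lamOf (c • lam₀)) z = c • dCnl L U₀ u₁ j (lamOf μ) (lamOf lam₀) z := by
  intro j hj z
  have h := fun ν => fderiv_Cc_apply hL hG hU hα hα3 hα2 h52 hu₁ hα₃ hα₃' hα₄ hs₁ hs₂ hs₃ hs₄ hs₅ hs₆ hs₇ hμ ν
    (⟨j, Nat.lt_succ_of_le hj⟩, z)
  rw [← h, ← h, map_smul]
  rfl

end Standing

end Literature.MathematicalPhysics.QuantumFieldTheory.Balaban1983to89.B8Eq1123LambdaSpace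

end
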